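import Summits.Ventures.PercRepro.Night2LocalR1ColC

/-!
# PercRepro — R1 columns, IV: `|S ∖ {y}| = 4` with a collinear triple on a line missing `≥ 2` points (night-2, gen 10)

`U := S ∖ {y}`, `K₀ := U ∖ {z₀}` collinear on `L := cl K₀`, `m := |P ∖ L| ≥ 2` (`P = G ∖ {y}`).  The spreading
members are triangles `U ∖ {x}`, `x ∈ K₀` (a spreading line member would have its line miss exactly one point of
`P`); the covering coloops are among `y` (identity `≤ 5/12`, only when `|G| ≥ 7`) and `z₀` (line cover `S ∖ {z₀}`,
weight `(5/4)/(m + 2) ≤ 5/16`).  For a triangle `T = {z₀, k, k′}` the two sides through `z₀` lie on lines meeting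
`L` only in `k`, resp. `k′`, and each other only in `z₀`, so `|L_{z₀k}| + |L_{z₀k′}| ≤ m + 3`, the two side weights
sum to `≤ 5/16 + (5/4)/|P|` (`two_sides_arith`), and the third side weighs `≤ 5/16`: `sideSum T ≤ 5/8 + (5/4)/|P|`
(`sideSum_erase_le_of_two_le_m`).  Every spread is then `≤ (1/24 + (5/4)/|P|)/(|G| − 4)` and the column is
`≤ 47/48` (`sum_r1W_col_le_of_card_four_of_two_le_m`; `3/4` when `|G| = 6`).  Then `sum_r1W_col_le_one` (all four
cases), **`shadowHall_five_three_of_simple`** (the `(5, 3)` diagonal shadow form for simple rank-`5` matroids) and the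
corollary `c025_five_three_of_shadow_simple`.
-/

namespace PercRepro.Shadow

open Finset PerFlat ThmH

variable {α : Type*} [DecidableEq α] {M : Matroid α} [M.Finite]

/-! ## The side sum of a spreading triangle -/

/-- `powersetCard 2 T ⊆ T.image (T.erase ·)` when `|T| = 3`. -/
theorem powersetCard_two_subset_image_erase {T : Finset α} (h3 : T.card = 3) :
    T.powersetCard 2 ⊆ T.image (fun e => T.erase e) := by
  intro K hK
  rw [Finset.mem_powersetCard] at hK
  obtain ⟨hKT, hK2⟩ := hK
  have : (T \ K).card = 1 := by rw [Finset.card_sdiff_of_subset hKT, h3, hK2]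
  obtain ⟨e, he⟩ := Finset.card_eq_one.1 this
  have heT : e ∈ T \ K := he ▸ Finset.mem_singleton_self e
  rw [Finset.mem_sdiff] at heT
  rw [Finset.mem_image]
  refine ⟨e, heT.1, ?_⟩
  ext f
  rw [Finset.mem_erase]
  constructor
  · rintro ⟨hfe, hfT⟩
    by_contra hfK
    have : f ∈ T \ K := Finset.mem_sdiff.2 ⟨hfT, hfK⟩
    rw [he, Finset.mem_singleton] at this
    exact hfe this
  · intro hfK
    exact ⟨fun h => heT.2 (h ▸ hfK), hKT hfK⟩

/-- In `T = {z₀} ∪ {k, k′}`, the side `T ∖ {k}` lies in `{z₀, k′}`. -/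
theorem erase_subset_pair {T : Finset α} {z₀ k k' : α} (hpair : T.erase z₀ = {k, k'}) :
    T.erase k ⊆ {z₀, k'} := by
  intro e he
  rw [Finset.mem_erase] at he
  rw [Finset.mem_insert, Finset.mem_singleton]
  by_cases hez : e = z₀
  · exact Or.inl hez
  · right
    have : e ∈ T.erase z₀ := Finset.mem_erase.2 ⟨hez, he.2⟩
    rw [hpair, Finset.mem_insert, Finset.mem_singleton] at this
    rcases this with h | h
    · exact absurd h he.1
    · exact h

open scoped Classical in
/-- **The side sum of a spreading triangle in the `m ≥ 2` case** is at most `5/8 + (5/4)/|P|`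
(`P = G ∖ {y}`): the side in `L` weighs `≤ (5/4)/(m + 2) ≤ 5/16`, the two sides through `z₀` together
`≤ 5/16 + (5/4)/|P|` (`two_sides_count`, `two_sides_arith`). -/
theorem sideSum_erase_le_of_two_le_m {G : Finset α} (hG : G ∈ flatsQ M 4)
    (hsimple : ∀ e ∈ G, ∀ f ∈ G, e ≠ f → rkN M {e, f} = 2) {y : α} (hyG : y ∈ G)
    (hycl : y ∉ clF M (G.erase y)) {U : Finset α} (hU : U ⊆ G.erase y) (hr : rkN M U = 3)
    (h4 : U.card = 4) {z₀ : α} (hz₀ : z₀ ∈ U) (hz₀r : rkN M (U.erase z₀) ≤ 2)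
    (hm : 2 ≤ ((G.erase y) \ clF M (U.erase z₀)).card) {x : α} (hx : x ∈ U.erase z₀)
    (hTr : rkN M (U.erase x) = 3) :
    sideSum M G (U.erase x) ≤ 5 / 8 + (5 / 4) / ((G.erase y).card : ℚ) := by
  have hGg := (mem_flatsQ.1 hG).1
  have hPg : G.erase y ⊆ gr M := (Finset.erase_subset _ _).trans hGg
  have hUg : U ⊆ gr M := hU.trans hPg
  have hxz : x ≠ z₀ := (Finset.mem_erase.1 hx).1
  have hxU : x ∈ U := (Finset.mem_erase.1 hx).2
  have hT3 : (U.erase x).card = 3 := by rw [Finset.card_erase_of_mem hxU, h4]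
  have hTP : U.erase x ⊆ G.erase y := (Finset.erase_subset _ _).trans hU
  have hclT : clF M (U.erase x) = G.erase y := clF_eq_erase_of_rkN_three hG hyG hycl hTP hTr
  have hPcl : clF M (G.erase y) = G.erase y := by rw [← hclT, clF_clF]
  have hz₀T : z₀ ∈ U.erase x := Finset.mem_erase.2 ⟨Ne.symm hxz, hz₀⟩
  have hK₀3 : (U.erase z₀).card = 3 := by rw [Finset.card_erase_of_mem hz₀, h4]
  have hK₀P : U.erase z₀ ⊆ G.erase y := (Finset.erase_subset _ _).trans hU
  have hK₀r : rkN M (U.erase z₀) = 2 :=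
    rkN_eq_two_of_le_two hsimple (hK₀P.trans (Finset.erase_subset _ _)) (by omega) hz₀r
  have hz₀L : z₀ ∉ clF M (U.erase z₀) := notMem_clF_erase_of_rkN_three hUg hr hz₀r
  -- the two other points of the triangle
  have hTz : (U.erase x).erase z₀ = (U.erase z₀).erase x := Finset.erase_right_comm
  have hTz2 : ((U.erase x).erase z₀).card = 2 := by rw [Finset.card_erase_of_mem hz₀T, hT3]
  obtain ⟨k, k', hkk', hpair⟩ := Finset.card_eq_two.1 hTz2
  have hkK₀ : k ∈ U.erase z₀ := by
    have : k ∈ (U.erase x).erase z₀ := hpair ▸ Finset.mem_insert_self _ _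
    rw [hTz] at this; exact (Finset.mem_erase.1 this).2
  have hk'K₀ : k' ∈ U.erase z₀ := by
    have : k' ∈ (U.erase x).erase z₀ := hpair ▸ Finset.mem_insert_of_mem (Finset.mem_singleton_self _)
    rw [hTz] at this; exact (Finset.mem_erase.1 this).2
  have hkT : k ∈ U.erase x := (Finset.mem_erase.1 (hpair ▸ Finset.mem_insert_self k {k'})).2
  have hk'T : k' ∈ U.erase x :=
    (Finset.mem_erase.1 (hpair ▸ Finset.mem_insert_of_mem (Finset.mem_singleton_self k'))).2
  have hz₀k : z₀ ≠ k := fun h => (Finset.mem_erase.1 hkK₀).1 h.symm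
  have hz₀k' : z₀ ≠ k' := fun h => (Finset.mem_erase.1 hk'K₀).1 h.symm
  -- the count
  obtain ⟨ha, hb, hab⟩ := two_sides_count hsimple (Finset.erase_subset _ _) hPcl hK₀P hK₀3 hK₀r (hU hz₀) hz₀L
    hkK₀ hk'K₀ hkk'
  have hn1 : 1 ≤ (G.erase y).card := Finset.card_pos.2 ⟨z₀, hU hz₀⟩
  have harith := two_sides_arith ha hb hab hn1
  -- the side in `L`
  have hL : (5 / 4 : ℚ) / ((((G.erase y) \ clF M ((U.erase x).erase z₀)).card : ℚ) + 2) ≤ 5 / 16 := by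
    calc (5 / 4 : ℚ) / ((((G.erase y) \ clF M ((U.erase x).erase z₀)).card : ℚ) + 2)
        ≤ (5 / 4) / ((((G.erase y) \ clF M (U.erase z₀)).card : ℚ) + 2) :=
          side_weight_mono (by rw [hTz]; exact Finset.erase_subset _ _)
      _ ≤ 5 / 16 := by
          have : (2 : ℚ) ≤ (((G.erase y) \ clF M (U.erase z₀)).card : ℚ) := by exact_mod_cast hm
          rw [div_le_iff₀ (by linarith)]
          linarith
  -- the sides through `z₀`
  have hk_side : (5 / 4 : ℚ) / ((((G.erase y) \ clF M ((U.erase x).erase k)).card : ℚ) + 2) ≤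
      (5 / 4) / ((((G.erase y) \ clF M {z₀, k'}).card : ℚ) + 2) :=
    side_weight_mono (erase_subset_pair hpair)
  have hk'_side : (5 / 4 : ℚ) / ((((G.erase y) \ clF M ((U.erase x).erase k')).card : ℚ) + 2) ≤
      (5 / 4) / ((((G.erase y) \ clF M {z₀, k}).card : ℚ) + 2) :=
    side_weight_mono (erase_subset_pair (by rw [hpair, Finset.pair_comm]))
  -- assemble
  unfold sideSum
  rw [hclT]
  calc ∑ K ∈ ((U.erase x).powersetCard 2).filter
        (fun K => 3 ≤ rkN M (G \ (K ∪ (G \ (G.erase y))))),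
        (5 / 4 : ℚ) / ((((G.erase y) \ clF M K).card : ℚ) + 2)
      ≤ ∑ K ∈ (U.erase x).image (fun e => (U.erase x).erase e),
          (5 / 4 : ℚ) / ((((G.erase y) \ clF M K).card : ℚ) + 2) := by
        apply Finset.sum_le_sum_of_subset_of_nonneg
          ((Finset.filter_subset _ _).trans (powersetCard_two_subset_image_erase hT3))
        intro K _ _
        exact div_nonneg (by norm_num) (add_nonneg (Nat.cast_nonneg _) (by norm_num))
    _ = ∑ e ∈ U.erase x, (5 / 4 : ℚ) / ((((G.erase y) \ clF M ((U.erase x).erase e)).card : ℚ) + 2) := by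
        rw [Finset.sum_image]
        intro e he e' he' h
        exact (Finset.erase_inj (U.erase x) he).1 h
    _ = (5 / 4 : ℚ) / ((((G.erase y) \ clF M ((U.erase x).erase z₀)).card : ℚ) + 2) +
        ∑ e ∈ (U.erase x).erase z₀,
          (5 / 4 : ℚ) / ((((G.erase y) \ clF M ((U.erase x).erase e)).card : ℚ) + 2) := by
        rw [← Finset.add_sum_erase _ _ hz₀T]
    _ = (5 / 4 : ℚ) / ((((G.erase y) \ clF M ((U.erase x).erase z₀)).card : ℚ) + 2) +
        ((5 / 4 : ℚ) / ((((G.erase y) \ clF M ((U.erase x).erase k)).card : ℚ) + 2) +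
          (5 / 4 : ℚ) / ((((G.erase y) \ clF M ((U.erase x).erase k')).card : ℚ) + 2)) := by
        rw [hpair, Finset.sum_pair hkk']
    _ ≤ 5 / 16 + (5 / 16 + (5 / 4) / ((G.erase y).card : ℚ)) := by
        have := add_le_add hk_side hk'_side
        linarith
    _ = 5 / 8 + (5 / 4) / ((G.erase y).card : ℚ) := by ring

/-! ## The column -/

open scoped Classical in
/-- **A collinear triple on a line missing `≥ 2` points of `P`**: the column is `≤ 47/48`. -/
theorem sum_r1W_col_le_of_card_four_of_two_le_m {G : Finset α} (hG : G ∈ flatsQ M 4)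
    (hd : (gr M \ G).card = 2) (h6 : 6 ≤ G.card)
    (hsimple : ∀ e ∈ G, ∀ f ∈ G, e ≠ f → rkN M {e, f} = 2) {y : α} (hyG : y ∈ G)
    (hycl : y ∉ clF M (G.erase y)) {S : Finset α} (hS : S ∈ shadowAt M 5 3 (Uq M 5 3) G)
    (h4 : (S.erase y).card = 4) {z₀ : α} (hz₀ : z₀ ∈ S.erase y)
    (hz₀r : rkN M ((S.erase y).erase z₀) ≤ 2)
    (hm : 2 ≤ ((G.erase y) \ clF M ((S.erase y).erase z₀)).card) :
    ∑ B ∈ membersIn M (Uq M 5 3) G, r1W M G B S ≤ 47 / 48 := by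
  have hyS := mem_of_mem_shadowAt_coloop hyG hycl hS
  have hSG := subset_of_mem_shadowAt hS
  have hU : S.erase y ⊆ G.erase y := erase_subset_erase_of_mem_shadowAt hS
  have hr : rkN M (S.erase y) = 3 := rkN_erase_of_mem_shadowAt hG hyG hycl hS
  have hz₀y : z₀ ≠ y := (Finset.mem_erase.1 hz₀).1
  have hn : (G.erase y).card + 1 = G.card := by rw [Finset.card_erase_of_mem hyG]; omega
  rw [sum_r1W_col_eq hS]
  -- every spreading member is a triangle `U ∖ {x}`, `x ≠ z₀`, with bounded spread
  have hspr : ∀ B ∈ sprPre M G S, ∃ x ∈ (S.erase y).erase z₀, B = (S.erase y).erase x ∧ rkN M B = 3 := by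
    intro B hB
    have hyB : y ∉ B := by
      intro hyB
      obtain ⟨-, -, h1⟩ := line_eq_of_mem_sprPre_mem hG hsimple hyG hycl hS h4 hz₀ hz₀r hB hyB
      omega
    obtain ⟨x, hxU, hBx, hBr⟩ := eq_erase_of_mem_sprPre_notMem hyS h4 hB hyB
    have hxz : x ≠ z₀ := by
      rintro rfl
      rw [hBx] at hBr
      omega
    exact ⟨x, Finset.mem_erase.2 ⟨hxz, hxU⟩, hBx, hBr⟩
  have hterm : ∀ B ∈ sprPre M G S, (5 / 12 - keepW M G B) / ((G.card - 4 : ℕ) : ℚ) ≤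
      (1 / 24 + (5 / 4) / ((G.erase y).card : ℚ)) / ((G.card - 4 : ℕ) : ℚ) := by
    intro B hB
    obtain ⟨x, hx, hBx, hBr⟩ := hspr B hB
    apply div_le_div_of_nonneg_right _ (by positivity)
    have hside := sideSum_erase_le_of_two_le_m hG hsimple hyG hycl hU hr h4 hz₀ hz₀r hm hx (hBx ▸ hBr)
    rw [hBx]
    calc 5 / 12 - keepW M G ((S.erase y).erase x) ≤ max 0 (sideSum M G ((S.erase y).erase x) - 7 / 12) :=
          spread_le G _
      _ ≤ 1 / 24 + (5 / 4) / ((G.erase y).card : ℚ) := by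
          apply max_le
          · positivity
          · linarith
  have hcard : (sprPre M G S).card ≤ 3 := by
    have hsub : sprPre M G S ⊆ ((S.erase y).erase z₀).image (fun x => (S.erase y).erase x) := by
      intro B hB
      obtain ⟨x, hx, hBx, -⟩ := hspr B hB
      rw [hBx]
      exact Finset.mem_image_of_mem _ hx
    calc (sprPre M G S).card ≤ (((S.erase y).erase z₀).image (fun x => (S.erase y).erase x)).card :=
          Finset.card_le_card hsub
      _ ≤ ((S.erase y).erase z₀).card := Finset.card_image_le
      _ = 3 := by rw [Finset.card_erase_of_mem hz₀, h4]
  have hsprsum : ∑ B ∈ sprPre M G S, (5 / 12 - keepW M G B) / ((G.card - 4 : ℕ) : ℚ) ≤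
      3 * ((1 / 24 + (5 / 4) / ((G.erase y).card : ℚ)) / ((G.card - 4 : ℕ) : ℚ)) := by
    calc ∑ B ∈ sprPre M G S, (5 / 12 - keepW M G B) / ((G.card - 4 : ℕ) : ℚ)
        ≤ ∑ B ∈ sprPre M G S, (1 / 24 + (5 / 4) / ((G.erase y).card : ℚ)) / ((G.card - 4 : ℕ) : ℚ) :=
          Finset.sum_le_sum hterm
      _ = ((sprPre M G S).card : ℚ) *
          ((1 / 24 + (5 / 4) / ((G.erase y).card : ℚ)) / ((G.card - 4 : ℕ) : ℚ)) := by
          rw [Finset.sum_const, nsmul_eq_mul]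
      _ ≤ 3 * ((1 / 24 + (5 / 4) / ((G.erase y).card : ℚ)) / ((G.card - 4 : ℕ) : ℚ)) := by
          have : ((sprPre M G S).card : ℚ) ≤ 3 := by exact_mod_cast hcard
          gcongr
  -- the covering part: `y` (identity, `|G| ≥ 7`) and `z₀` (line cover `≤ 5/16`)
  have hZ := covZ_subset_pair hsimple hycl hS hyS hr h4 hz₀ hz₀r
  have hcovz₀ : covW M G (S.erase z₀) ≤ 5 / 16 := by
    have hKU : (S.erase y).erase z₀ ⊆ G.erase y := (Finset.erase_subset _ _).trans hU
    have hsd : G \ clF M (S.erase z₀) = (G.erase y) \ clF M ((S.erase y).erase z₀) := by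
      have : S.erase z₀ = insert y ((S.erase y).erase z₀) := by
        rw [Finset.erase_right_comm, Finset.insert_erase (Finset.mem_erase.2 ⟨Ne.symm hz₀y, hyS⟩)]
      rw [this, sdiff_clF_insert_coloop hG hyG hycl hKU]
    calc covW M G (S.erase z₀) ≤ (5 / 4) / (((G \ clF M (S.erase z₀)).card : ℚ) + 2) := covW_le_cov G _
      _ ≤ 5 / 16 := by
          rw [hsd]
          have : (2 : ℚ) ≤ (((G.erase y) \ clF M ((S.erase y).erase z₀)).card : ℚ) := by exact_mod_cast hm
          rw [div_le_iff₀ (by linarith)]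
          linarith
  have hcovy : covW M G (S.erase y) ≤ 5 / 12 :=
    covW_le G _ (by rw [sdiff_clF_eq_singleton_of_rkN_three hG hyG hycl hU hr, Finset.card_singleton])
  have hn5 : (5 : ℚ) ≤ ((G.erase y).card : ℚ) := by exact_mod_cast (by omega : 5 ≤ (G.erase y).card)
  by_cases hyZ : y ∈ covZ M G S
  · have h7 : 7 ≤ G.card := by have := card_le_of_mem_covZ hd hyZ hSG; omega
    have hcov : ∑ z ∈ covZ M G S, covW M G (S.erase z) ≤ 5 / 12 + 5 / 16 := by
      calc ∑ z ∈ covZ M G S, covW M G (S.erase z) ≤ ∑ z ∈ ({y, z₀} : Finset α), covW M G (S.erase z) :=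
            Finset.sum_le_sum_of_subset_of_nonneg hZ (fun z _ _ => covW_nonneg G _)
        _ = covW M G (S.erase y) + covW M G (S.erase z₀) := Finset.sum_pair (Ne.symm hz₀y)
        _ ≤ 5 / 12 + 5 / 16 := add_le_add hcovy hcovz₀
    have hn6 : (6 : ℚ) ≤ ((G.erase y).card : ℚ) := by exact_mod_cast (by omega : 6 ≤ (G.erase y).card)
    have hfrac : (5 / 4 : ℚ) / ((G.erase y).card : ℚ) ≤ 5 / 24 := by
      rw [div_le_iff₀ (by linarith)]; linarith
    have hg : (3 : ℚ) ≤ ((G.card - 4 : ℕ) : ℚ) := by exact_mod_cast (by omega : 3 ≤ G.card - 4)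
    have hspr' : (1 / 24 + (5 / 4) / ((G.erase y).card : ℚ)) / ((G.card - 4 : ℕ) : ℚ) ≤ 1 / 12 := by
      rw [div_le_iff₀ (by linarith)]; linarith
    linarith
  · have hZ' : covZ M G S ⊆ {z₀} := by
      intro z hz
      have := hZ hz
      rw [Finset.mem_insert, Finset.mem_singleton] at this
      rw [Finset.mem_singleton]
      rcases this with rfl | h
      · exact absurd hz hyZ
      · exact h
    have hcov : ∑ z ∈ covZ M G S, covW M G (S.erase z) ≤ 5 / 16 := by
      calc ∑ z ∈ covZ M G S, covW M G (S.erase z) ≤ ∑ z ∈ ({z₀} : Finset α), covW M G (S.erase z) :=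
            Finset.sum_le_sum_of_subset_of_nonneg hZ' (fun z _ _ => covW_nonneg G _)
        _ = covW M G (S.erase z₀) := Finset.sum_singleton _ _
        _ ≤ 5 / 16 := hcovz₀
    have hfrac : (5 / 4 : ℚ) / ((G.erase y).card : ℚ) ≤ 1 / 4 := by
      rw [div_le_iff₀ (by linarith)]; linarith
    have hg : (2 : ℚ) ≤ ((G.card - 4 : ℕ) : ℚ) := by exact_mod_cast (by omega : 2 ≤ G.card - 4)
    have hspr' : (1 / 24 + (5 / 4) / ((G.erase y).card : ℚ)) / ((G.card - 4 : ℕ) : ℚ) ≤ 7 / 48 := by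
      rw [div_le_iff₀ (by linarith)]; linarith
    linarith

/-! ## Every column is `≤ 1`; the `(5, 3)` diagonal for simple matroids -/

open scoped Classical in
/-- **Every R1 column at a type-`(2, 1)` flat of a simple matroid is `≤ 1`**: `|U| = 3`
(`sum_r1W_col_le_one_of_card_three`), `|U| = 4` without a collinear triple (`≤ 35/36`), with a collinear
triple on a line missing one point (`≤ 5/6`) or `≥ 2` points (`≤ 47/48`), `|U| ≥ 5` (`≤ 5/6`). -/
theorem sum_r1W_col_le_one {G : Finset α} (hG : G ∈ flatsQ M 4) (hd : (gr M \ G).card = 2)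
    (h6 : 6 ≤ G.card) (hsimple : ∀ e ∈ G, ∀ f ∈ G, e ≠ f → rkN M {e, f} = 2) {y : α} (hyG : y ∈ G)
    (hycl : y ∉ clF M (G.erase y)) {S : Finset α} (hS : S ∈ shadowAt M 5 3 (Uq M 5 3) G) :
    ∑ B ∈ membersIn M (Uq M 5 3) G, r1W M G B S ≤ 1 := by
  have hr : rkN M (S.erase y) = 3 := rkN_erase_of_mem_shadowAt hG hyG hycl hS
  have h3 : 3 ≤ (S.erase y).card := by have := rkN_le_card (M := M) (S.erase y); omega
  rcases Nat.lt_or_ge (S.erase y).card 5 with hlt | hge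
  · rcases Nat.lt_or_ge (S.erase y).card 4 with hlt4 | hge4
    · exact sum_r1W_col_le_one_of_card_three hG hd hyG hycl hS (by omega)
    · have h4 : (S.erase y).card = 4 := by omega
      by_cases hcol : ∃ z₀ ∈ S.erase y, rkN M ((S.erase y).erase z₀) ≤ 2
      · obtain ⟨z₀, hz₀, hz₀r⟩ := hcol
        have hU : S.erase y ⊆ G.erase y := erase_subset_erase_of_mem_shadowAt hS
        have hm1 : 1 ≤ ((G.erase y) \ clF M ((S.erase y).erase z₀)).card := by
          rw [Nat.one_le_iff_ne_zero, Ne, Finset.card_eq_zero, Finset.sdiff_eq_empty_iff_subset]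
          intro hsub
          have := rkN_mono (M := M) (hU.trans hsub)
          rw [rkN_clF] at this
          omega
        rcases Nat.lt_or_ge ((G.erase y) \ clF M ((S.erase y).erase z₀)).card 2 with hm | hm
        · exact (sum_r1W_col_le_of_card_four_of_m_one hG hsimple hyG hycl hS h4 hz₀ hz₀r (by omega)).trans
            (by norm_num)
        · exact (sum_r1W_col_le_of_card_four_of_two_le_m hG hd h6 hsimple hyG hycl hS h4 hz₀ hz₀r hm).trans
            (by norm_num)
      · exact (sum_r1W_col_le_of_card_four_of_no_collinear hG hd h6 hyG hycl hS h4
          (fun x hx hle => hcol ⟨x, hx, hle⟩)).trans (by norm_num)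
  · exact (sum_r1W_col_le_of_five_le hG hsimple hyG hycl hS hge).trans (by norm_num)

/-- In a simple matroid of rank `≥ 2` every ground element is a nonloop. -/
theorem isNonloop_of_simple (hsimple : ∀ e ∈ gr M, ∀ f ∈ gr M, e ≠ f → rkN M {e, f} = 2)
    (h2 : 2 ≤ rkN M (gr M)) {e : α} (he : e ∈ gr M) : M.IsNonloop e := by
  have hc : 2 ≤ (gr M).card := h2.trans (rkN_le_card (M := M) (gr M))
  obtain ⟨f, hf⟩ : ((gr M).erase e).Nonempty :=
    Finset.card_pos.1 (by rw [Finset.card_erase_of_mem he]; omega)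
  rw [Finset.mem_erase] at hf
  have h := hsimple e he f hf.2 (Ne.symm hf.1)
  have h1 := rkN_union_le_add_card (M := M) {e} {f}
  rw [← Finset.insert_eq, h, Finset.card_singleton] at h1
  have hle := rkN_le_card (M := M) {e}
  rw [Finset.card_singleton] at hle
  have h1' : rkN M {e} = 1 := by omega
  rw [← Matroid.eRk_singleton_eq_one_iff, ← Finset.coe_singleton, eRk_eq_rkN, h1']
  norm_num

open scoped Classical in
/-- **The `(5, 3)` diagonal shadow form for simple rank-`5` matroids**: if any two distinct ground elements
have rank `2` and `ρ(E) = 5`, then `ShadowHall M 5 3 (5/4)` — every sub-family `𝒜` of the rank-`3` sets with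
rank-`5` complement has at least `(5/4)·#𝒜` rank-`4` sets above it (`Φ(5, 3) = 5/4`). -/
theorem shadowHall_five_three_of_simple (hsimple : ∀ e ∈ gr M, ∀ f ∈ gr M, e ≠ f → rkN M {e, f} = 2)
    (hrk : M.eRk ((gr M : Finset α) : Set α) = ((5 : ℕ) : ℕ∞)) :
    ShadowHall M 5 3 (((3 : ℕ) + 2 : ℚ) / ((3 : ℕ) + 1 : ℚ)) := by
  have hl : ∀ e ∈ gr M, M.IsNonloop e := by
    intro e he
    apply isNonloop_of_simple hsimple _ he
    have : rkN M (gr M) = 5 := by unfold rkN; rw [hrk]; rfl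
    omega
  apply shadowHall_five_three_of_r1W_columns hl hrk
  intro G hG hd hex h6 S hS
  have hGg := (mem_flatsQ.1 hG).1
  have hsimpleG : ∀ e ∈ G, ∀ f ∈ G, e ≠ f → rkN M {e, f} = 2 :=
    fun e he f hf hef => hsimple e (hGg he) f (hGg hf) hef
  obtain ⟨B, hB, hm⟩ := hex
  have hclB : clF M B ⊆ G := (mem_membersIn.1 hB).2
  obtain ⟨y, hy⟩ := Finset.card_eq_one.1 hm
  have hyGc : y ∈ G \ clF M B := hy ▸ Finset.mem_singleton_self y
  rw [Finset.mem_sdiff] at hyGc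
  have hycl : y ∉ clF M (G.erase y) := by
    rw [← clF_eq_erase_of_sdiff_eq_singleton hclB hy, clF_clF]
    exact hyGc.2
  exact sum_r1W_col_le_one hG hd h6 hsimpleG hyGc.1 hycl hS

/-- The shadow form specialises to the body of `C025` at `(5, 3)` (Theorem O of the cell, `ThmO.c025_five_three_all`,
already holds on every finite matroid; this corollary only records the link `ShadowHall → Hall → C025` for the
simple case, with `Φ(5, 3) = C(8, 4)/C(8, 5) = 5/4`). -/
theorem c025_five_three_of_shadow_simple (hsimple : ∀ e ∈ gr M, ∀ f ∈ gr M, e ≠ f → rkN M {e, f} = 2)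
    (hrk : M.eRk ((gr M : Finset α) : Set α) = ((5 : ℕ) : ℕ∞)) :
    phiK 5 3 *
      ({A : Set α | A ⊆ M.E ∧ M.eRk A = ((5 : ℕ) : ℕ∞) ∧ M.eRk (M.E \ A) = ((3 : ℕ) : ℕ∞)}.ncard : ℚ) ≤
      ({A : Set α | A ⊆ M.E ∧ ((3 : ℕ) : ℕ∞) < M.eRk A ∧ M.eRk A < ((5 : ℕ) : ℕ∞)}.ncard : ℚ) := by
  have hphi : phiK 5 3 = ((3 : ℕ) + 2 : ℚ) / ((3 : ℕ) + 1 : ℚ) := by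
    unfold phiK
    rw [show Finset.Ioo 3 5 = {4} by decide, Finset.sum_singleton,
      show Nat.choose (5 + 3) 4 = 70 by decide, show Nat.choose (5 + 3) 5 = 56 by decide]
    norm_num
  rw [hphi]
  exact c025_of_hall (hall_of_shadowHall (shadowHall_five_three_of_simple hsimple hrk))

end PercRepro.Shadow
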